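import Mathlib
import HarnessLib
import Summits.FinalStateConjecture.FinalStateConjecture.Statement

/-!
# Crux `RecurrentlyFlatDisperses` (stmt-FinalStateConjecture-14665), line `Sketch`
# (card `outgoing-blind-cup-restart`) — registered stub `stub_settlesOfCapture`

PACKAGING: capture data (future completeness of every normalised null ray from the data hypersurface,
and a convergent anchored flat late chart `Φ : U₁ → 𝒟`, `{x⁰ > τ₁} ⊆ U₁`, which is a late chart into
its self-determined exterior `O₁ = J⁺(Σ) ∩ I⁻(Φ{x⁰ > τ₁})` with `deviationCk … 2 τ → 0` and the
covering/exhaustion clause for every `τ ≥ τ₁`) give the Statement's conclusion: complete `𝓘⁺`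
(`LorentzianMetric.hasCompleteFutureNullInfinity_of_forall_not_bddAbove`, under the
`[HasLeviCivita]` binder of `Summit.FinalStateConjecture.HasCompleteNullInfinity`) and the `N = 0`
`FinalStateDecomposition 𝒟.toSpacetime O₁ 2` (flat domain `U₁`, flat chart `Φ`, no holes; compare
`FinalStateDecomposition.ofConvergesToMinkowski`) with `O₁ = exteriorOf d.charted`
(`d.charted = Φ '' lateRegion τ₁ ∪ ⋃ over Fin 0`) and `HasExhaustiveCharts d` (radii `Fin 0 → _`;
`certifiedLate`/`certifiedSlab` reduce to the flat pieces).
-/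

noncomputable section

open scoped Manifold ContDiff Topology
open Filter Set TopologicalSpace Literature.Geometry.Lorentzian

namespace Summit.FinalStateConjecture.FinalStateConjecture.Theorems.RecurrentlyFlatDisperses

/-- **Capture data settle the development** (registered stub `stub_settlesOfCapture` of crux
stmt-FinalStateConjecture-14665, `CaptureData 𝒟 → Settles 𝒟` unfolded). -/
theorem stub_settlesOfCapture :
    ∀ (X : Type) [TopologicalSpace X] [ChartedSpace E3 X] [IsManifold (𝓡 3) ∞ X] [T2Space X]
      [SecondCountableTopology X] [ConnectedSpace X] (D : InitialDataSet (𝓡 3) X)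
      (𝒟 : VacuumCauchyDevelopment D),
        ((∀ [𝒟.metric.HasLeviCivita], ∀ (p : X) (γ : ℝ → 𝒟.carrier) (dom : Set ℝ),
              𝒟.metric.IsNormalisedNullRayFrom 𝒟.timeOrientation 𝒟.embed 𝒟.normal p γ dom →
                ¬ BddAbove dom) ∧
          ∃ (τ₁ : ℝ) (U₁ : Opens E4) (Φ : U₁ → 𝒟.carrier),
            {x : E4 | τ₁ < x 0} ⊆ (U₁ : Set E4) ∧
            𝒟.toSpacetime.IsLateChart (Minkowski.backgroundOn U₁)
              (Summit.FinalStateConjecture.exteriorOf 𝒟.toCauchyDevelopment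
                (Φ '' (Minkowski.backgroundOn U₁).lateRegion τ₁)) τ₁ Φ ∧
            Tendsto (fun τ ↦ 𝒟.toSpacetime.deviationCk (Minkowski.backgroundOn U₁) Φ 2 τ)
              atTop (𝓝 0) ∧
            (∀ τ : ℝ, τ₁ ≤ τ →
              Summit.FinalStateConjecture.exteriorOf 𝒟.toCauchyDevelopment
                  (Φ '' (Minkowski.backgroundOn U₁).lateRegion τ₁) \
                    Φ '' (Minkowski.backgroundOn U₁).lateRegion τ ⊆
                𝒟.metric.causalPast 𝒟.timeOrientation
                  (Φ '' (Minkowski.backgroundOn U₁).timeSlab τ))) →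
        (Summit.FinalStateConjecture.HasCompleteNullInfinity 𝒟.toCauchyDevelopment ∧
          ∃ (O : Set 𝒟.carrier) (d : FinalStateDecomposition 𝒟.toSpacetime O 2),
            (∀ i, Kerr.IsSubextremal (d.mass i) (d.spin i)) ∧
              O = Summit.FinalStateConjecture.exteriorOf 𝒟.toCauchyDevelopment d.charted ∧
                Summit.FinalStateConjecture.HasExhaustiveCharts d) := by
  intro X _ _ _ _ _ _ D 𝒟 h
  obtain ⟨hnull, τ₁, U₁, Φ, hU, hlate, hdev, hexh⟩ := h
  refine ⟨?_, ?_⟩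
  · -- (a) complete `𝓘⁺`: every normalised null ray from the data is future complete
    intro _
    exact LorentzianMetric.hasCompleteFutureNullInfinity_of_forall_not_bddAbove hnull
  · -- (b) the `N = 0` decomposition of the self-determined exterior of the flat chart
    let O' : Set 𝒟.carrier := Summit.FinalStateConjecture.exteriorOf 𝒟.toCauchyDevelopment
      (Φ '' (Minkowski.backgroundOn U₁).lateRegion τ₁)
    let d : FinalStateDecomposition 𝒟.toSpacetime O' 2 :=
      { N := 0
        mass := Fin.elim0
        spin := Fin.elim0
        mass_pos := fun i ↦ i.elim0
        abs_spin_le_mass := fun i ↦ i.elim0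
        motion := Fin.elim0
        τ₀ := τ₁
        chart := fun i ↦ i.elim0
        isLateChart := fun i ↦ i.elim0
        tendsto_truncDeviationCk := fun i ↦ i.elim0
        exists_pairwise_disjoint := fun _ ↦ ⟨0, fun i ↦ i.elim0⟩
        excision := Fin.elim0
        tendsto_excision_div := fun i ↦ i.elim0
        flatDomain := U₁
        setOf_lt_excision_subset_flatDomain := fun x hx ↦ hU hx.1
        flatChart := Φ
        isLateChart_flat := hlate
        tendsto_deviationCk_flat := hdev
        diff_subset_causalPast := by
          intro p hp
          have hp2 : p ∉ Φ '' (Minkowski.backgroundOn U₁).lateRegion τ₁ :=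
            fun h' ↦ hp.2 (Or.inr h')
          have hJ := hexh τ₁ le_rfl ⟨hp.1, hp2⟩
          exact LorentzianMetric.causalFuture_mono subset_union_right hJ }
    -- `HasExhaustiveCharts` re-typed (Statement audit T2, 2026-08-16: honest radii clause);
    -- for `N = 0` every clause over `Fin 0` is vacuous (repair, continuation lead c5)
    refine ⟨O', d, fun i ↦ i.elim0, ?_,
      ⟨fun i ↦ i.elim0, fun i ↦ i.elim0, fun i ↦ i.elim0, fun τ hτ ↦ ?_⟩⟩
    · -- `O' = J⁺(ι X) ∩ I⁻(d.charted)`, as `d.charted = Φ '' {x⁰ > τ₁} ∪ ⋃ (over Fin 0)`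
      have hch : d.charted = Φ '' (Minkowski.backgroundOn U₁).lateRegion τ₁ := by
        ext p
        simp only [FinalStateDecomposition.charted, Set.mem_union, Set.mem_iUnion]
        constructor
        · rintro (h' | ⟨i, -⟩)
          · exact h'
          · exact i.elim0
        · exact fun h' ↦ Or.inl h'
      rw [hch]
    · -- exhaustion at chart time `τ > τ₁`: the certified pieces are the flat ones
      intro p hp
      have hp2 : p ∉ Φ '' (Minkowski.backgroundOn U₁).lateRegion τ := fun h' ↦ hp.2 (Or.inl h')
      have hJ := hexh τ (le_of_lt hτ) ⟨hp.1, hp2⟩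
      exact LorentzianMetric.causalFuture_mono subset_union_left hJ

end Summit.FinalStateConjecture.FinalStateConjecture.Theorems.RecurrentlyFlatDisperses

end
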